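import Summits.HodgeConjecture.HodgeConjecture.Theorems.PeriodDeficiencyQbarGenericIsHodgeGenericStubMtRankHodgeEqOfIso
import Literature.Barriers.HodgeConjecture.ConjugateVarietiesProofs
import Literature.AlgebraicGeometry.Motives.BaseChangeProofs
import Summits.HodgeConjecture.HodgeConjecture.Theorems.PeriodDeficiencyQbarGenericIsHodgeGenericStubFiberOverConjPointIso
import HarnessLib

/-!
# Crux `QbarGenericIsHodgeGeneric` (HGQ, stmt-HodgeConjecture-11595), line `registered`: the open
# core holds whenever the automorphism fixes a field of definition

Helper file (`--supports stmt-HodgeConjecture-11595`) of the line lead c2. The one open stub of the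
line is its family-free core (ii-b) `stub_mtRank_hodge_conjugateVariety`: for a classical Betti–Hodge
datum `B`, `τ ∈ Aut(ℂ/ℚ̄)` and `X` smooth projective over `ℂ`,
`dim MT(Hⁱ(X^τ)) = dim MT(Hⁱ(X))` (`X^τ = Motives.conjugateVariety τ X`) — open on paper (Deligne's
absolute-Hodge territory; Klingler–Otwinowska–Urbanik 2023 Conj. 1.5(a) in family-free form) and
kernel-proved equivalent to HGQ modulo known mathematics (`Theorems.core_of_qbarGenericIsHodgeGeneric`,
`Theorems.qbarGenericIsHodgeGeneric_of_core`).

This file records, sorry-free, the exact BOUNDARY of what is formal about (ii-b): **the core holds for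
every pair `(X, τ)` such that `τ` fixes a field of definition of `X`** — if `X ≅ V ×_{K,φ} ℂ` for a
`K`-scheme `V` and `τ ∘ φ = φ`, then `X^τ ≅ X` over `ℂ` (Charles 2009 §1: `(V_φ)^τ ≅ V_{τφ}`, the tree's
`nonempty_iso_conjugateVariety_baseChangeHom`), and the Mumford–Tate rank of `B.hodge` is invariant
under `ℂ`-isomorphisms (`stub_mtRank_hodge_eq_of_iso`, p154941). In particular (ii-b) holds for every
`X` definable over `ℚ̄` (`mtRank_hodge_conjugateVariety_of_qbarModel`): in the family picture these
are the fibres over `ℚ̄`-POINTS of `S₀`, where HGQ is tautological (`W(s) = {s}`), so the entire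
content of (ii-b) — and of the crux — sits at varieties whose field of moduli is transcendental, in
accordance with the route's thesis (a transcendence count is the only lever that distinguishes `X_s`
from `X_{τs}`). No classicality of `B` is needed for these statements.

## References
* [Charles2009Conjugate] F. Charles, Conjugate varieties with distinct real cohomology algebras,
  J. reine angew. Math. 630 (2009), §1.
* [KlinglerOtwinowskaUrbanik2023] B. Klingler, A. Otwinowska, D. Urbanik, Ann. Sci. ÉNS 56 (2023),
  §1.2, Conj. 1.5(a).
* [VoisinHodgeI2002] C. Voisin, Hodge Theory and Complex Algebraic Geometry I, §7.3.2.
-/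

noncomputable section

-- every declaration of this problem lives in `Summit.HodgeConjecture.HodgeConjecture.…` (problem = summit)
set_option linter.dupNamespace false

namespace Summit.HodgeConjecture.HodgeConjecture.Theorems

open CategoryTheory AlgebraicGeometry
open Literature.AlgebraicGeometry.Motives Literature.AlgebraicGeometry.HodgeTheory

universe u

/-- **`(V ×_{K,φ} ℂ)^τ ≅ V ×_{K,φ} ℂ` over `ℂ` when `τ ∘ φ = φ`**: the conjugate of a base change is
the base change along the conjugated embedding (`nonempty_iso_conjugateVariety_baseChangeHom`,
Charles 2009 §1), and `τ ∘ φ = φ`. [cite: Charles2009Conjugate, §1] -/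
theorem nonempty_iso_conjugateVariety_baseChangeHom_of_comp_eq {K : Type u} [Field K] {L : Type u}
    [Field L] (V : SchemeOver K) (φ : K →+* L) (τ : L ≃+* L) (hτ : τ.toRingHom.comp φ = φ) :
    Nonempty (conjugateVariety τ ((baseChangeHom φ).obj V) ≅ (baseChangeHom φ).obj V) := by
  obtain ⟨e⟩ := Literature.Barriers.HodgeConjecture.nonempty_iso_conjugateVariety_baseChangeHom V φ τ
  rw [hτ] at e
  exact ⟨e⟩

/-- **The core holds for `(X, τ)` as soon as `X^τ ≅ X` over `ℂ`** (`stub_mtRank_hodge_eq_of_iso`: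
the Mumford–Tate rank of `B.hodge` is invariant under `ℂ`-isomorphisms of smooth projective
varieties). [cite: VoisinHodgeI2002, §7.3.2] -/
theorem mtRank_hodge_conjugateVariety_of_nonempty_iso (B : BettiHodgeData ℂ) [HodgeTensorFacts.{0, 0}]
    (τ : ℂ ≃+* ℂ) {n : ℕ} {X : SchemeOver ℂ} (hX : IsSmoothProjective n X) (i : ℕ)
    [Module.Finite ℚ (B.W.obj X i)] [Module.Finite ℚ (B.W.obj (conjugateVariety τ X) i)]
    (he : Nonempty (conjugateVariety τ X ≅ X)) :
    (B.hodge (IsSmoothProjective.conjugateVariety_holds τ hX) i).mtRank = (B.hodge hX i).mtRank := by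
  obtain ⟨e⟩ := he
  exact stub_mtRank_hodge_eq_of_iso B e (IsSmoothProjective.conjugateVariety_holds τ hX) hX i

/-- **The core holds whenever `τ` fixes a field of definition of `X`**: for a `K`-scheme `V`, an
embedding `φ : K →+* ℂ`, `τ ∈ Aut(ℂ)` with `τ ∘ φ = φ`, and `X ≅ V ×_{K,φ} ℂ` smooth projective,
`dim MT(Hⁱ(X^τ)) = dim MT(Hⁱ(X))` for every Betti–Hodge datum `B` — since then
`X^τ ≅ (V_φ)^τ ≅ V_{τφ} = V_φ ≅ X` over `ℂ` (functoriality of `conjugateVariety τ = (baseChangeHom τ).obj`,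
`nonempty_iso_conjugateVariety_baseChangeHom_of_comp_eq`). The open stub (ii-b) is this statement
WITHOUT the hypothesis `τ ∘ φ = φ` for some model `(K, φ, V)` of `X`, i.e. it concerns exactly the
pairs `(X, τ)` with `τ` moving every field of definition of `X`. [cite: Charles2009Conjugate, §1]
[cite: KlinglerOtwinowskaUrbanik2023, §1.2] -/
theorem mtRank_hodge_conjugateVariety_of_model :
    ∀ (B : BettiHodgeData ℂ) [HodgeTensorFacts.{0, 0}] {K : Type} [Field K] (φ : K →+* ℂ)
      (τ : ℂ ≃+* ℂ), τ.toRingHom.comp φ = φ → ∀ (V : SchemeOver K) ⦃n : ℕ⦄ ⦃X : SchemeOver ℂ⦄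
      (_ : X ≅ (baseChangeHom φ).obj V) (hX : IsSmoothProjective n X) (i : ℕ)
      [Module.Finite ℚ (B.W.obj X i)] [Module.Finite ℚ (B.W.obj (conjugateVariety τ X) i)],
      (B.hodge (IsSmoothProjective.conjugateVariety_holds τ hX) i).mtRank = (B.hodge hX i).mtRank := by
  intro B _ K _ φ τ hτ V n X eX hX i _ _
  refine mtRank_hodge_conjugateVariety_of_nonempty_iso B τ hX i ?_
  obtain ⟨e⟩ := nonempty_iso_conjugateVariety_baseChangeHom_of_comp_eq V φ τ hτ
  -- `X^τ ≅ (V_φ)^τ ≅ V_φ ≅ X`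
  exact ⟨(baseChangeHom τ.toRingHom).mapIso eX ≪≫ e ≪≫ eX.symm⟩

/-- **The open core (ii-b) holds for every smooth projective variety definable over `ℚ̄`**: for
`σ : ℚ̄ →+* ℂ`, `τ ∈ Aut(ℂ/σℚ̄)` (`HodgeTheory.ringAutOver σ`, so `τ ∘ σ = σ`), a `ℚ̄`-scheme `X₀` and
`X ≅ X₀ ⊗_σ ℂ` smooth projective: `dim MT(Hⁱ(X^τ)) = dim MT(Hⁱ(X))` — the instance of
`mtRank_hodge_conjugateVariety_of_model` at `K = ℚ̄`. In the family picture of the crux these are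
the fibres over the `ℚ̄`-points of the base, where HGQ is tautological; the registered stub
`stub_mtRank_hodge_conjugateVariety` is the same statement for ALL smooth projective `X` over `ℂ`.
[cite: KlinglerOtwinowskaUrbanik2023, §1.2 and Conj. 1.5(a)] -/
theorem mtRank_hodge_conjugateVariety_of_qbarModel :
    ∀ (B : BettiHodgeData ℂ) [HodgeTensorFacts.{0, 0}] (σ : AlgebraicClosure ℚ →+* ℂ)
      (τ : ringAutOver σ) (X₀ : SchemeOver (AlgebraicClosure ℚ)) ⦃n : ℕ⦄ ⦃X : SchemeOver ℂ⦄
      (_ : X ≅ (baseChangeHom σ).obj X₀) (hX : IsSmoothProjective n X) (i : ℕ)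
      [Module.Finite ℚ (B.W.obj X i)]
      [Module.Finite ℚ (B.W.obj (conjugateVariety
        (@AlgEquiv.toRingEquiv (AlgebraicClosure ℚ) ℂ ℂ _ _ _ σ.toAlgebra σ.toAlgebra τ) X) i)],
      (B.hodge (IsSmoothProjective.conjugateVariety_holds
        (@AlgEquiv.toRingEquiv (AlgebraicClosure ℚ) ℂ ℂ _ _ _ σ.toAlgebra σ.toAlgebra τ) hX) i).mtRank =
        (B.hodge hX i).mtRank := by
  intro B _ σ τ X₀ n X eX hX i _ _
  exact mtRank_hodge_conjugateVariety_of_model B σ _ (ringAutOver_toRingHom_comp σ τ) X₀ eX hX i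

end Summit.HodgeConjecture.HodgeConjecture.Theorems

end
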